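import Summits.QuantumFields.YangMills.Theorems.UnitScaleTiltProp7SPrintProp2OfThm2
import Summits.QuantumFields.YangMills.Theorems.UnitScaleTiltProp7SPrintStraight
import HarnessLib

/-!
# Route `UnitScaleTilt`, crux K1 child «MinimiserStabilityRegPr» (stmt-QuantumFields-19200), registered stub `stub_prop7From14` (skeleton birth_v7
# cc37a178…; leaf V3), pillar P-V3-A′ — **ROW (C135) DISCHARGED: [Balaban1985RegularSpaces] (1.35) FOR PRINT'S BASED LETTERS FROM
# [Balaban1985Variational] (14) + (18) AT THE T³ CARRIER**, hence **`prop2Printed_sPrint_of_thm2`: the v8 pillar text `B11.Prop2Printed …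
# (famLG3 L (sPrint L T))` FROM [6] THEOREM 2 FOR THE BASED LETTERS ALONE** (row T2 of `Prop7SPrintProp2.prop2Printed_sPrint_of_thm2Based`)

Cell `ym3-torus` ∕ width seat `ym-ust-19200-w1` (gen 0; D-0149; HUMAN RULING D-0037 — YM₃ on T³ is ladder rung R3, not the Clay problem).  WHY.
`Prop7SPrintProp2.prop2Printed_sPrint_of_thm2Based` (p584429) reduces P-V3-A′ at `S_print` to two rows: (T2) [6] Thm 2 for the based letters and (C135)
its hypothesis (1.35) from (14) + (18).  `Prop7SPrintStraight` compares both averagings of a small field with the straight transporter between the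
`k`-centres; here the five-term chain `Ū♯ — straight(U) — Ū^{(k)} — Ū₀^{(k)} — straight(U₀) — Ū₀♯` gives (1.35) with `α₁ = b + C_L(ε₀ + a)`, closing
(C135), and P-V3-A′ follows from (T2) alone.

WHAT IS PROVED (sorry-free, no definition).  **`cond135_based_of_sat14_mem`** — ROW (C135): `Cond135T L k (U₀♯_{x₀}) (U′♯_{x₀}) (b + C_L(ε₀ + a))`,
`C_L = 2(14336 + (21/20)((5L)²/4)(10800L + 1))`, for `U₀ ∈ 𝔘_k(a)`, `|Ū₀ − V| < b` (family's averaging), `U` in print's regular fibre (6)(ε₀) of `V`,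
`ε₀, a ≤ (10⁸L³)⁻¹`; **`prop2Printed_sPrint_of_thm2`** — `∃ B₁′ c₁′ > 0, B11.Prop2Printed B₁′ B₃ L³ c₁′ (famLG3 L (sPrint L T))` (every Sect. C–E tail `T`,
every `B₃ ≥ 0`) FROM ROW (T2) ALONE: the existence half of [6] Thm 2 at the T³ carrier for print's based letters, (3.35)-free — the shape of
`B8Thm2SetupTorus.Thm2SetupSUAt`'s conclusion read at `x₀` (OWNER RULING g23-№3 (c2)).

HONEST SCOPE.  [6] Theorem 2 (row T2) remains a HYPOTHESIS (interface `Thm2SetupSUAt`; XL, not in the tree at a curved background); everything else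
between it and the v8 pillar P-V3-A′ at `S_print` is now a theorem.  Count-neutral helper toward stmt-QuantumFields-19200 (`--supports`), not a proof
of the stub; nothing continuum ∕ OS ∕ mass-gap ∕ Clay.

References: T. Bałaban, CMP **102** (1985) 277–309 [Balaban1985Variational] ((14)–(18) p.280, Prop. 2 p.281); CMP **99** (1985) 75–102
[Balaban1985RegularSpaces] ((1.33)–(1.35) p.82, Thm 2 p.83); CMP **98** (1985) 17–51 [Balaban1985Averaging] ((24) p.21, (43) p.24, Prop. 1 (51) p.26).
-/

noncomputable section

namespace Summit.QuantumFields.YangMills.Theorems.Prop7SPrintCond135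

open scoped Matrix.Norms.L2Operator BigOperators
open NormedSpace
open Literature.MathematicalPhysics.QuantumFieldTheory.Balaban1983to89
open Literature.MathematicalPhysics.QuantumFieldTheory.Balaban1983to89.T3ContinuumYM3Torus
open Literature.MathematicalPhysics.QuantumFieldTheory.Balaban1983to89.T3UnitLawDensityEML (ℰp)
open Literature.MathematicalPhysics.QuantumFieldTheory.Balaban1983to89.T3PrintedRegularMinimiser (RegPr regFibrePr mem_regFibrePr_iff)
open Literature.MathematicalPhysics.QuantumFieldTheory.Balaban1983to89.T3RegularMinimiser (regThreshold)
open Literature.MathematicalPhysics.QuantumFieldTheory.Balaban1983to89.T3ConstrainedMinimiser (fibre)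
open Literature.MathematicalPhysics.QuantumFieldTheory.Balaban1983to89.T3TiltDescent (descendTo)
open Literature.MathematicalPhysics.QuantumFieldTheory.Balaban1983to89.T3LevelShift (bondShift fieldShift fieldShift_apply)
open T4Continuum BlockAveraging ExpMeanLog LatticeWordStokes
open B7Prop1Explicit renaming Site → LSite
open B7Prop1Explicit (e hol seg seg_natCast)
open B7Prop2Explicit (avgIter pdev C0 c2' C0_pos c2'_pos AvgClosed)
open B7AvgClosedSpecialUnitarySharp (avgClosed_specialUnitary_of_le_twentyone)
open B7Eq47AveragedBondVsStraight (norm_avgIter_sub_straight_le)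
open B8Thm2TorusAt (Cond135T)
open B15DeterminingSets (embIter)
open B10Eq27TorusAxialLog (transl pull pull_apply hol_pull holT holT_eq_holAt holT_toUField val_holT_unitsField unitsField val_unitsField
  toUField val_suIncl)
open B11 (Prop2Printed)
open T3Thm1Carrier
open T3SectALandauChart (ResidFam famLG3 pert emb15 eta bgUnits CloseAvg pos_of_regPr)
open Summit.QuantumFields.YangMills.Theorems.Prop7SPrint (basePt IsAxialPrint RestrictedPrint sPrint)
open Summit.QuantumFields.YangMills.Theorems.Prop7AxialReprPrint (pdev_pull_lt inAk_pull_of_regPr pull_toUField_mem)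
open Summit.QuantumFields.YangMills.Theorems.Prop7AxialSpace18Print (transl_embIter_zero_smul)
open Summit.QuantumFields.YangMills.Theorems.IterPlaqSmall (dist1_holAt_avgFun_mul_inv_le iter_succ_eq length_flatMap_replicate
  dist1_corr_le_of_loopHol one_div_fifty_lt_deltaSU_fin_two)
open Summit.QuantumFields.YangMills.Theorems.IterPlaqSmallAllL (plaqSmall_iter_T3_allL)

open Summit.QuantumFields.YangMills.Theorems.Prop7SPrintStraight (dist1_iter_mul_inv_straight_le norm_avgIter_pull_sub_straight_le
  coe_hol_pull_replicate norm_coe_sub_coe_eq_dist1 pull_bgUnits_pert_mul norm_iter_sub_iter_lt)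

/-! ## §5 Row (C135), and P-V3-A′ at `S_print` from [6] Theorem 2 for the based letters alone -/

section Main

variable (F : T3Family) {n K : ℕ}

/-- **ROW (C135): [Balaban1985RegularSpaces] (1.35) FOR PRINT'S BASED LETTERS FROM [Balaban1985Variational] (14) + (18).**  For a member (`n < K`,
`k = K − n`, `x₀ = basePt F n K`), a background `U₀ ∈ 𝔘_k(a)` (both clauses of (2)) with `|Ū₀ − V| < b` in the family's averaging and `U` in print's regular
fibre (6)(ε₀) of `V`, with `ε₀, a ≤ (10⁸L³)⁻¹`: at every level-`k` bond `(z, ν)` the (43) averages of the based pullbacks satisfy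
`‖(U′♯U₀♯)‾ᵏ − (U₀♯)‾ᵏ‖ < b + C_L(ε₀ + a)`, `C_L = 2(14336 + (21/20)((5L)²/4)(10800L + 1))` — five-term chain through the straight transporter between
the `k`-centres `embIter k y` and `embIter k (y + e_ν)` (§2, §3 for `U` and `U₀`, §4). [cite: Balaban1985RegularSpaces, (1.35) p.82; Balaban1985Variational, (14) and (18) p.280; Balaban1985Averaging, Prop. 1 (51) p.26] -/
theorem cond135_based_of_sat14_mem (hnK : n < K) {ε₀ a b : ℝ}
    {V : GaugeField (F.P n) 0 (Matrix.specialUnitaryGroup (Fin 2) ℂ)} {U₀ U : GaugeField (F.P K) 0 (Matrix.specialUnitaryGroup (Fin 2) ℂ)}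
    (hreg₀ : RegPr F n K a U₀) (hclose : CloseAvg F n K hnK.le b V U₀) (hU : U ∈ regFibrePr F n K hnK.le ε₀ V)
    (hε₀e : ε₀ ≤ (10 ^ 8 * (F.L : ℝ) ^ 3)⁻¹) (hae : a ≤ (10 ^ 8 * (F.L : ℝ) ^ 3)⁻¹) :
    Cond135T (F.P K).L (K - n) (pull (bgUnits F K U₀) (basePt F n K)) (pull (bgUnits F K (pert U₀ U)) (basePt F n K))
      (b + 2 * (14336 + 21 / 20 * (((5 * (F.L : ℝ)) ^ 2 / 4) * (10800 * (F.L : ℝ) + 1))) * (ε₀ + a)) := by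
  intro z ν
  rw [pull_bgUnits_pert_mul]
  -- letters
  have hd : (F.P K).d = 3 := T3Family.P_d F K
  have hLL : ((F.P K).L : ℝ) = F.L := rfl
  have hL3 : 3 ≤ F.L := by obtain ⟨c, hc⟩ := F.hL.1; have := F.hL.2; omega
  have hL3r : (3 : ℝ) ≤ F.L := by exact_mod_cast hL3
  have hL0 : (0 : ℝ) < F.L := by linarith
  have hL3pow : (27 : ℝ) ≤ (F.L : ℝ) ^ 3 := by
    have h := pow_le_pow_left₀ (by norm_num : (0 : ℝ) ≤ 3) hL3r 3
    linarith [show ((3 : ℝ)) ^ 3 = 27 by norm_num]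
  have hd' : (((F.P K).d : ℕ) : ℝ) = 3 := by rw [hd]; norm_num
  obtain ⟨hUfib, hregU⟩ := (mem_regFibrePr_iff F).mp hU
  have hε₀ : 0 < ε₀ := pos_of_regPr F hregU
  have ha : 0 < a := pos_of_regPr F hreg₀
  -- smallness in the three regimes used
  have hinv : (10 ^ 8 * (F.L : ℝ) ^ 3)⁻¹ * (10 ^ 8 * (F.L : ℝ) ^ 3) = 1 := inv_mul_cancel₀ (by positivity)
  have hsm : ∀ t : ℝ, 0 < t → t ≤ (10 ^ 8 * (F.L : ℝ) ^ 3)⁻¹ →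
      10 ^ 7 * (F.L : ℝ) ^ 3 * t ≤ 1 ∧ C0 (F.P K).d * (2 * t) ≤ 1 / 3 ∧ 2 * (2 * t) ≤ c2' (F.P K).d (F.P K).L := by
    intro t ht hte
    have h1 : 10 ^ 8 * (F.L : ℝ) ^ 3 * t ≤ 1 := by
      have := mul_le_mul_of_nonneg_left hte (by positivity : (0 : ℝ) ≤ 10 ^ 8 * (F.L : ℝ) ^ 3)
      rwa [mul_comm (10 ^ 8 * (F.L : ℝ) ^ 3) ((10 ^ 8 * (F.L : ℝ) ^ 3)⁻¹), hinv] at this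
    have h27 : 27 * (10 ^ 8 * t) ≤ 1 := by nlinarith [hL3pow, ht.le]
    have hL2t : 0 ≤ (F.L : ℝ) ^ 2 * t := by positivity
    refine ⟨by nlinarith, ?_, ?_⟩
    · rw [hd, C0]; push_cast
      nlinarith
    · rw [hd, c2', hLL]; push_cast
      rw [le_div_iff₀ (by positivity)]
      have hL1 : (1 : ℝ) ≤ F.L := by linarith
      have hcube : (F.L : ℝ) ^ 2 * t ≤ (F.L : ℝ) ^ 3 * t := by nlinarith
      nlinarith
  obtain ⟨hε7, hε3, hε2⟩ := hsm ε₀ hε₀ hε₀e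
  obtain ⟨ha7, ha3, ha2⟩ := hsm a ha hae
  -- the `k`-centres reached from `x₀`
  have hk : K - n ≤ (F.P K).m + (F.P K).K := by show K - n ≤ F.m + K; omega
  obtain ⟨y, hy⟩ := transl_embIter_zero_smul (P := F.P K) hk z
  -- the straight transporters (as matrices)
  have hS : ∀ W : GaugeField (F.P K) 0 (Matrix.specialUnitaryGroup (Fin 2) ℂ),
      ((hol (pull (bgUnits F K W) (basePt F n K)) (((F.P K).L : ℤ) ^ (K - n) • z) (seg ν (((F.P K).L ^ (K - n) : ℕ) : ℤ)) :
          (Matrix (Fin 2) (Fin 2) ℂ)ˣ) : Matrix (Fin 2) (Fin 2) ℂ) =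
        ((holAt W (walk (embIter (K - n) y) (List.replicate ((F.P K).L ^ (K - n)) (ν, true))) : Matrix.specialUnitaryGroup (Fin 2) ℂ) :
          Matrix (Fin 2) (Fin 2) ℂ) := by
    intro W
    rw [← hy]
    exact coe_hol_pull_replicate W (basePt F n K) _ ν _
  -- §3 for `U` and `U₀`
  have hA : ∀ (W : GaugeField (F.P K) 0 (Matrix.specialUnitaryGroup (Fin 2) ℂ)) (t : ℝ), 0 < t → RegPr F n K t W →
      C0 (F.P K).d * (2 * t) ≤ 1 / 3 → 2 * (2 * t) ≤ c2' (F.P K).d (F.P K).L →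
      ‖((avgIter (F.P K).L (pull (bgUnits F K W) (basePt F n K)) (K - n) z ν : (Matrix (Fin 2) (Fin 2) ℂ)ˣ) : Matrix (Fin 2) (Fin 2) ℂ) -
          ((holAt W (walk (embIter (K - n) y) (List.replicate ((F.P K).L ^ (K - n)) (ν, true))) : Matrix.specialUnitaryGroup (Fin 2) ℂ) :
            Matrix (Fin 2) (Fin 2) ℂ)‖ ≤ 14336 * t := by
    intro W t ht hW ht3 ht2
    have h := norm_avgIter_pull_sub_straight_le F ht ht3 ht2 hW (basePt F n K) z ν
    rw [hS W, hd'] at h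
    refine h.trans (le_of_eq ?_)
    ring
  -- §2 for `U` and `U₀`
  have hD : ∀ (W : GaugeField (F.P K) 0 (Matrix.specialUnitaryGroup (Fin 2) ℂ)) (t : ℝ), 0 < t → RegPr F n K t W →
      10 ^ 7 * (F.L : ℝ) ^ 3 * t ≤ 1 →
      ‖((Averaging.iter (fun i => blockAvg (P := F.P K) (j := i) ℰp) (K - n) W ⟨y, ν⟩ : Matrix.specialUnitaryGroup (Fin 2) ℂ) :
            Matrix (Fin 2) (Fin 2) ℂ) -
          ((holAt W (walk (embIter (K - n) y) (List.replicate ((F.P K).L ^ (K - n)) (ν, true))) : Matrix.specialUnitaryGroup (Fin 2) ℂ) :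
            Matrix (Fin 2) (Fin 2) ℂ)‖ ≤ 21 / 20 * (((5 * (F.L : ℝ)) ^ 2 / 4) * ((10800 * (F.L : ℝ) + 1) * t)) := by
    intro W t ht hW ht7
    rw [norm_coe_sub_coe_eq_dist1]
    exact dist1_iter_mul_inv_straight_le F n K ht ht7 W hW.plaqSmall y ν
  -- §4
  have hB := norm_iter_sub_iter_lt F hnK.le hclose hUfib ⟨y, ν⟩
  -- the chain
  set AU := ((avgIter (F.P K).L (pull (bgUnits F K U) (basePt F n K)) (K - n) z ν : (Matrix (Fin 2) (Fin 2) ℂ)ˣ) : Matrix (Fin 2) (Fin 2) ℂ)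
  set A0 := ((avgIter (F.P K).L (pull (bgUnits F K U₀) (basePt F n K)) (K - n) z ν : (Matrix (Fin 2) (Fin 2) ℂ)ˣ) : Matrix (Fin 2) (Fin 2) ℂ)
  set SU := ((holAt U (walk (embIter (K - n) y) (List.replicate ((F.P K).L ^ (K - n)) (ν, true))) : Matrix.specialUnitaryGroup (Fin 2) ℂ) :
    Matrix (Fin 2) (Fin 2) ℂ)
  set S0 := ((holAt U₀ (walk (embIter (K - n) y) (List.replicate ((F.P K).L ^ (K - n)) (ν, true))) : Matrix.specialUnitaryGroup (Fin 2) ℂ) :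
    Matrix (Fin 2) (Fin 2) ℂ)
  set DU := ((Averaging.iter (fun i => blockAvg (P := F.P K) (j := i) ℰp) (K - n) U ⟨y, ν⟩ : Matrix.specialUnitaryGroup (Fin 2) ℂ) :
    Matrix (Fin 2) (Fin 2) ℂ)
  set D0 := ((Averaging.iter (fun i => blockAvg (P := F.P K) (j := i) ℰp) (K - n) U₀ ⟨y, ν⟩ : Matrix.specialUnitaryGroup (Fin 2) ℂ) :
    Matrix (Fin 2) (Fin 2) ℂ)
  have h1 : ‖AU - SU‖ ≤ 14336 * ε₀ := hA U ε₀ hε₀ hregU hε3 hε2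
  have h2 : ‖DU - SU‖ ≤ 21 / 20 * (((5 * (F.L : ℝ)) ^ 2 / 4) * ((10800 * (F.L : ℝ) + 1) * ε₀)) := hD U ε₀ hε₀ hregU hε7
  have h3 : ‖DU - D0‖ < b := hB
  have h4 : ‖D0 - S0‖ ≤ 21 / 20 * (((5 * (F.L : ℝ)) ^ 2 / 4) * ((10800 * (F.L : ℝ) + 1) * a)) := hD U₀ a ha hreg₀ ha7
  have h5 : ‖A0 - S0‖ ≤ 14336 * a := hA U₀ a ha hreg₀ ha3 ha2
  have hCE : 0 ≤ 21 / 20 * (((5 * (F.L : ℝ)) ^ 2 / 4) * (10800 * (F.L : ℝ) + 1)) := by positivity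
  calc ‖AU - A0‖ ≤ ‖AU - SU‖ + ‖SU - DU‖ + ‖DU - D0‖ + ‖D0 - S0‖ + ‖S0 - A0‖ := by
        have e1 := norm_sub_le_norm_sub_add_norm_sub AU SU A0
        have e2 := norm_sub_le_norm_sub_add_norm_sub SU DU A0
        have e3 := norm_sub_le_norm_sub_add_norm_sub DU D0 A0
        have e4 := norm_sub_le_norm_sub_add_norm_sub D0 S0 A0
        linarith
    _ < 14336 * ε₀ + 21 / 20 * (((5 * (F.L : ℝ)) ^ 2 / 4) * ((10800 * (F.L : ℝ) + 1) * ε₀)) + b +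
          21 / 20 * (((5 * (F.L : ℝ)) ^ 2 / 4) * ((10800 * (F.L : ℝ) + 1) * a)) + 14336 * a := by
        rw [norm_sub_rev SU DU, norm_sub_rev S0 A0]
        linarith
    _ ≤ b + 2 * (14336 + 21 / 20 * (((5 * (F.L : ℝ)) ^ 2 / 4) * (10800 * (F.L : ℝ) + 1))) * (ε₀ + a) := by
        nlinarith [hε₀.le, ha.le]

/-- **P-V3-A′ AT `S_print` FROM [6] THEOREM 2 FOR THE BASED LETTERS ALONE**: the v8 pillar text `∃ B₁′ c₁′ > 0, B11.Prop2Printed B₁′ B₃ L³ c₁′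
(famLG3 L (sPrint L T))` (every Sect. C–E tail `T`, every `B₃ ≥ 0`) follows from row (T2) of `Prop7SPrintProp2.prop2Printed_sPrint_of_thm2Based` — the
existence half of [Balaban1985RegularSpaces] Thm 2 at the T³ carrier for print's based letters, (3.35)-free (= `B8Thm2SetupTorus.Thm2SetupSUAt` at
`x₀`-translated data by `Prop7BasedTranslate`, OWNER RULING g23-№3 (c2)) — row (C135) being `cond135_based_of_sat14_mem`.
[cite: Balaban1985Variational, Prop. 2 p.281, (14)-(18) p.280; Balaban1985RegularSpaces, Thm 2 p.83, (1.33)-(1.35) p.82] -/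
theorem prop2Printed_sPrint_of_thm2 {L : ℕ} (T : ResidFam L) {B₃ B₁ c₁ : ℝ} (hB₃ : 0 ≤ B₃) (hB₁ : 0 < B₁) (hc₁ : 0 < c₁)
    (hT2 : ∀ (F : T3Family), F.L = L → ∀ (n K : ℕ), n < K → ∀ (α₀ α₁ : ℝ), 0 < α₀ → 0 < α₁ → α₀ + α₁ ≤ c₁ →
      ∀ (U₀ U : GaugeField (F.P K) 0 (Matrix.specialUnitaryGroup (Fin 2) ℂ)),
        RegPr F n K α₀ U₀ → RegPr F n K α₀ U → IsAxialPrint F n K U₀ U →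
        Cond135T (F.P K).L (K - n) (pull (bgUnits F K U₀) (basePt F n K)) (pull (bgUnits F K (pert U₀ U)) (basePt F n K)) α₁ →
        ∃ (u : GaugeTransf (F.P K) 0 (Matrix.specialUnitaryGroup (Fin 2) ℂ))
          (U₁ : GaugeField (F.P K) 0 (Matrix.specialUnitaryGroup (Fin 2) ℂ)) (A : PBond (F.P K) 0 → Matrix (Fin 2) (Fin 2) ℂ),
          RestrictedPrint F n K U₀ u ∧ GaugeField.gaugeAct u (emb15 U₀ U₁) = U ∧ (∀ b : PBond (F.P K) 0, IsSelfAdjoint (A b)) ∧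
          (∀ b : PBond (F.P K) 0,
            ((U₁ b : Matrix.specialUnitaryGroup (Fin 2) ℂ) : Matrix (Fin 2) (Fin 2) ℂ) = exp (Complex.I • ((eta F n K) • A b))) ∧
          (∃ (β₀ B₂ : ℝ) (len : LSite (F.P K).d → ℝ),
            B8Thm2TorusAt.C136T (F.P K).L (K - n) (eta F n K) β₀ B₁ B₂ len (α₀ + α₁) (pull (bgUnits F K U₀) (basePt F n K))
              (pull A (basePt F n K))) ∧
          B8Eq138LandauZd.IsLandau138 (F.P K).L (K - n) (eta F n K) (Set.univ : Set (LSite (F.P K).d)) (B8Thm4TorusAt.torusLam (K - n))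
            (pull (bgUnits F K U₀) (basePt F n K)) (pull A (basePt F n K)) ∧
          B8Thm2TorusAt.C139T (F.P K).L (K - n) (eta F n K) B₁ (α₀ + α₁) (pull (bgUnits F K U₀) (basePt F n K)) (pull A (basePt F n K))) :
    ∃ B₁' c₁' : ℝ, 0 < B₁' ∧ 0 < c₁' ∧ Prop2Printed B₁' B₃ ((L : ℝ) ^ 3) c₁' (famLG3 L (sPrint L T)) := by
  by_cases hL : 1 < L
  · have hL0 : (0 : ℝ) < L := by exact_mod_cast (lt_trans zero_lt_one hL)
    exact Summit.QuantumFields.YangMills.Theorems.Prop7SPrintProp2.prop2Printed_sPrint_of_thm2Based T hB₃ hB₁ hc₁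
      (C := 2 * (14336 + 21 / 20 * (((5 * (L : ℝ)) ^ 2 / 4) * (10800 * (L : ℝ) + 1)))) (e := (10 ^ 8 * (L : ℝ) ^ 3)⁻¹)
      (by positivity) (by positivity) hT2
      (fun F hF n K hnK ε₀ a b V U₀ U hreg₀ hclose hU hε₀e hae => by
        have h := cond135_based_of_sat14_mem F hnK hreg₀ hclose hU (by rw [hF]; exact hε₀e) (by rw [hF]; exact hae)
        rwa [hF] at h)
  · -- no member of the family has block size `L ≤ 1`: the printed statement is vacuous
    refine ⟨1, 1, one_pos, one_pos, ?_⟩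
    intro i
    exact absurd (i.2.1 ▸ i.1.1.hL.2) hL

end Main

end Summit.QuantumFields.YangMills.Theorems.Prop7SPrintCond135

end
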